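import Mathlib
import Summits.NavierStokesRegularity.NavierStokesRegularity.Theorems.DssFarFieldSlavingBlowupTypeIDssProfileSimilarityEnstrophyCutoffBudget
import Literature.Analysis.FluidPDE.SobolevWholeSpace
import Literature.Analysis.FluidPDE.HessianLaplacian
import HarnessLib

/-!
# Small-dissipation gap for the finite-dissipation stratum, file 1/3: the SQUARED radial cutoff and
  the time derivative / budget identity of the localised similarity enstrophy against it
  (route `LerayQuarterDissipation`, crux `FiniteDissipationLiouville` stmt-NavierStokesRegularity-22144,
  BC5 rung `stub_smallDissipationGap`; `--supports` helper; seat ns-lqd-p2)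

HONEST FRAMING. Label-free analysis helper about a HYPOTHETICAL object — a Type-I ancient mild
solution in the Koch–Nadirashvili–Seregin–Šverák gauge (`IsTypeIAncientMild C V`) — under the
ADDITIONAL hypothesis that the similarity slices have uniformly square-integrable gradient
`∫ ‖DU(s)‖² ≤ K_U`. Nothing here bears on Navier–Stokes regularity or blow-up; no summit is proved.

CONTENTS (this file). With `U = lerayOrbit V`, `Ω = lerayVorticity V = curl U` and the radial cutoff
`φ_R(y) = smoothTransition (2 − ‖y‖²/R²)` of crux `MustSqueeze`: the SQUARED weight `φ_R²` (smooth,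
supported in `B̄_{2R}`, `= 1` on `B̄_R`, `D(φ_R²) = 2φ_R Dφ_R` so `‖D(φ_R²)‖ ≤ 2c₁/R`, ray-monotone,
`|Δ(φ_R²)| ≤ 2c₂/R² + 6(c₁/R)²` by the Leibniz rule `laplacian_mul_eq`), the time derivative of
`Z_R(s) = ∫ φ_R² ‖Ω(s)‖²` (differentiation under the integral sign) and the budget identity
`Z_R' = −½Z_R + ½∫(y·∇φ_R²)‖Ω‖² + ∫(U·∇φ_R²)‖Ω‖² + 2∫φ_R²⟪DUΩ,Ω⟫ + ∫‖Ω‖²Δφ_R² − 2∫φ_R²‖∇Ω‖²_F` — the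
tree's `signedBudget_enstrophy_identity` (valid for every `C_c^∞` weight) at `φ_R²`. The square is
what lets file 2/3 write the stretching term as `2∫⟪DU(φ_RΩ), φ_RΩ⟫` with a `C_c¹` test field
`φ_RΩ` and price it by Ladyzhenskaya's inequality and the GLOBAL `Ḣ¹` bound of the slice instead of
the Type-I constant. [folklore]
-/

noncomputable section

set_option linter.dupNamespace false

namespace Summit.NavierStokesRegularity.NavierStokesRegularity.Theorems.SmallDissipationGap

open MeasureTheory Set Filter Topology Metric InnerProductSpace Function Real
open scoped RealInnerProductSpace Laplacian ContDiff
open Literature.Analysis Literature.Analysis.FluidPDE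
open Summit.NavierStokesRegularity.NavierStokesRegularity.Theorems
open Summit.NavierStokesRegularity.NavierStokesRegularity.Theorems.GaussianGap
open Summit.NavierStokesRegularity.NavierStokesRegularity.Theorems.SimilarityEnstrophy

variable {C : ℝ} {V : ℝ → (EuclideanSpace ℝ (Fin 3)) → (EuclideanSpace ℝ (Fin 3))}

/-! ### The squared cutoff `φ_R²` -/

section Cutoff

/-- `φ_R²` is smooth. [folklore] -/
theorem contDiff_sqCutoff {n : ℕ∞} (R : ℝ) :
    ContDiff ℝ n fun y : (EuclideanSpace ℝ (Fin 3)) => smoothTransition (2 - ‖y‖ ^ 2 / R ^ 2) ^ 2 :=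
  (contDiff_smoothTransition_cutoff R).pow 2

/-- `φ_R²` vanishes off `closedBall 0 (2R)`. [folklore] -/
theorem sqCutoff_eq_zero_of_notMem {R : ℝ} (hR : 0 < R) {y : (EuclideanSpace ℝ (Fin 3))}
    (hy : y ∉ closedBall (0 : (EuclideanSpace ℝ (Fin 3))) (2 * R)) : smoothTransition (2 - ‖y‖ ^ 2 / R ^ 2) ^ 2 = 0 := by
  rw [smoothTransition_cutoff_eq_zero_of_notMem hR hy, zero_pow two_ne_zero]

/-- `φ_R²` has compact support. [folklore] -/
theorem hasCompactSupport_sqCutoff {R : ℝ} (hR : 0 < R) :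
    HasCompactSupport fun y : (EuclideanSpace ℝ (Fin 3)) => smoothTransition (2 - ‖y‖ ^ 2 / R ^ 2) ^ 2 :=
  HasCompactSupport.intro (isCompact_closedBall (0 : (EuclideanSpace ℝ (Fin 3))) (2 * R))
    fun _ hy => sqCutoff_eq_zero_of_notMem hR hy

/-- `0 ≤ φ_R² ≤ 1`. [folklore] -/
theorem sqCutoff_nonneg (R : ℝ) (y : (EuclideanSpace ℝ (Fin 3))) : 0 ≤ smoothTransition (2 - ‖y‖ ^ 2 / R ^ 2) ^ 2 :=
  sq_nonneg _

/-- `φ_R² ≤ 1`. [folklore] -/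
theorem sqCutoff_le_one (R : ℝ) (y : (EuclideanSpace ℝ (Fin 3))) : smoothTransition (2 - ‖y‖ ^ 2 / R ^ 2) ^ 2 ≤ 1 := by
  have h0 := smoothTransition_cutoff_nonneg R y
  have h1 := smoothTransition_cutoff_le_one R y
  nlinarith

/-- `φ_R² = 1` on `closedBall 0 R`. [folklore] -/
theorem sqCutoff_eq_one {R : ℝ} (hR : 0 < R) {y : (EuclideanSpace ℝ (Fin 3))} (hy : ‖y‖ ≤ R) :
    smoothTransition (2 - ‖y‖ ^ 2 / R ^ 2) ^ 2 = 1 := by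
  rw [smoothTransition_cutoff_eq_one hR hy, one_pow]

/-- Chain rule: `D(φ_R²)(y) = 2 φ_R(y) • Dφ_R(y)`. [folklore] -/
theorem fderiv_sqCutoff (R : ℝ) (y : (EuclideanSpace ℝ (Fin 3))) :
    fderiv ℝ (fun z : (EuclideanSpace ℝ (Fin 3)) => smoothTransition (2 - ‖z‖ ^ 2 / R ^ 2) ^ 2) y =
      (2 * smoothTransition (2 - ‖y‖ ^ 2 / R ^ 2)) •
        fderiv ℝ (fun z : (EuclideanSpace ℝ (Fin 3)) => smoothTransition (2 - ‖z‖ ^ 2 / R ^ 2)) y := by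
  have hd : DifferentiableAt ℝ (fun z : (EuclideanSpace ℝ (Fin 3)) => smoothTransition (2 - ‖z‖ ^ 2 / R ^ 2)) y :=
    (contDiff_smoothTransition_cutoff (n := 1) R).differentiable one_ne_zero y
  have h : fderiv ℝ (fun z : (EuclideanSpace ℝ (Fin 3)) => smoothTransition (2 - ‖z‖ ^ 2 / R ^ 2) *
      smoothTransition (2 - ‖z‖ ^ 2 / R ^ 2)) y = _ := (hd.hasFDerivAt.mul hd.hasFDerivAt).fderiv
  have e : (fun z : (EuclideanSpace ℝ (Fin 3)) => smoothTransition (2 - ‖z‖ ^ 2 / R ^ 2) ^ 2) =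
      fun z : (EuclideanSpace ℝ (Fin 3)) => smoothTransition (2 - ‖z‖ ^ 2 / R ^ 2) * smoothTransition (2 - ‖z‖ ^ 2 / R ^ 2) := by
    funext z; rw [sq]
  rw [e, h, two_mul, add_smul]

/-- `‖D(φ_R²)‖ ≤ 2 c₁/R` from `‖Dφ_R‖ ≤ c₁/R` and `0 ≤ φ_R ≤ 1`. [folklore] -/
theorem norm_fderiv_sqCutoff_le {c₁ : ℝ}
    (hc₁ : ∀ R : ℝ, 0 < R → ∀ y : (EuclideanSpace ℝ (Fin 3)),
      ‖fderiv ℝ (fun z : (EuclideanSpace ℝ (Fin 3)) => smoothTransition (2 - ‖z‖ ^ 2 / R ^ 2)) y‖ ≤ c₁ / R)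
    {R : ℝ} (hR : 0 < R) (y : (EuclideanSpace ℝ (Fin 3))) :
    ‖fderiv ℝ (fun z : (EuclideanSpace ℝ (Fin 3)) => smoothTransition (2 - ‖z‖ ^ 2 / R ^ 2) ^ 2) y‖ ≤ 2 * (c₁ / R) := by
  have h1 := smoothTransition_cutoff_le_one R y
  have h0 := smoothTransition_cutoff_nonneg R y
  rw [fderiv_sqCutoff, norm_smul, Real.norm_eq_abs,
    abs_of_nonneg (mul_nonneg zero_le_two h0)]
  have hc := hc₁ R hR y
  have hc0 : 0 ≤ c₁ / R := (norm_nonneg _).trans hc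
  calc 2 * smoothTransition (2 - ‖y‖ ^ 2 / R ^ 2) *
        ‖fderiv ℝ (fun z : (EuclideanSpace ℝ (Fin 3)) => smoothTransition (2 - ‖z‖ ^ 2 / R ^ 2)) y‖
      ≤ 2 * 1 * (c₁ / R) := by gcongr
    _ = 2 * (c₁ / R) := by ring

/-- Off `closedBall 0 (2R)` the gradient of `φ_R²` vanishes. [folklore] -/
theorem fderiv_sqCutoff_eq_zero {R : ℝ} (hR : 0 < R) {y : (EuclideanSpace ℝ (Fin 3))}
    (hy : y ∉ closedBall (0 : (EuclideanSpace ℝ (Fin 3))) (2 * R)) :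
    fderiv ℝ (fun z : (EuclideanSpace ℝ (Fin 3)) => smoothTransition (2 - ‖z‖ ^ 2 / R ^ 2) ^ 2) y = 0 := by
  rw [fderiv_sqCutoff, signedBudget_fderiv_cutoff_eq_zero hR hy, smul_zero]

/-- Ray monotonicity survives squaring: `D(φ_R²)(y) y = 2 φ_R(y) · Dφ_R(y) y ≤ 0`. [folklore] -/
theorem fderiv_sqCutoff_self_nonpos (R : ℝ) (y : (EuclideanSpace ℝ (Fin 3))) :
    fderiv ℝ (fun z : (EuclideanSpace ℝ (Fin 3)) => smoothTransition (2 - ‖z‖ ^ 2 / R ^ 2) ^ 2) y y ≤ 0 := by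
  rw [fderiv_sqCutoff]
  show (2 * smoothTransition (2 - ‖y‖ ^ 2 / R ^ 2)) *
    fderiv ℝ (fun z : (EuclideanSpace ℝ (Fin 3)) => smoothTransition (2 - ‖z‖ ^ 2 / R ^ 2)) y y ≤ 0
  exact mul_nonpos_iff.2 (Or.inl ⟨mul_nonneg zero_le_two (smoothTransition_cutoff_nonneg R y),
    fderiv_smoothTransition_cutoff_self_nonpos R y⟩)

/-- **Laplacian of the squared cutoff**: `|Δ(φ_R²)| ≤ 2 c₂/R² + 6 (c₁/R)²` from the Leibniz rule
`Δ(φ²) = 2φΔφ + 2Σᵢ(∂ᵢφ)²`, `|Δφ_R| ≤ c₂/R²`, `‖Dφ_R‖ ≤ c₁/R`. [folklore] -/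
theorem abs_laplacian_sqCutoff_le {c₁ c₂ : ℝ}
    (hc₁ : ∀ R : ℝ, 0 < R → ∀ y : (EuclideanSpace ℝ (Fin 3)),
      ‖fderiv ℝ (fun z : (EuclideanSpace ℝ (Fin 3)) => smoothTransition (2 - ‖z‖ ^ 2 / R ^ 2)) y‖ ≤ c₁ / R)
    (hc₂ : ∀ R : ℝ, 0 < R → ∀ y : (EuclideanSpace ℝ (Fin 3)),
      |(Δ (fun z : (EuclideanSpace ℝ (Fin 3)) => smoothTransition (2 - ‖z‖ ^ 2 / R ^ 2))) y| ≤ c₂ / R ^ 2)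
    {R : ℝ} (hR : 0 < R) (y : (EuclideanSpace ℝ (Fin 3))) :
    |(Δ (fun z : (EuclideanSpace ℝ (Fin 3)) => smoothTransition (2 - ‖z‖ ^ 2 / R ^ 2) ^ 2)) y| ≤
      2 * (c₂ / R ^ 2) + 6 * (c₁ / R) ^ 2 := by
  set φ : (EuclideanSpace ℝ (Fin 3)) → ℝ := fun z => smoothTransition (2 - ‖z‖ ^ 2 / R ^ 2) with hφ
  have hφ2 : ContDiff ℝ 2 φ := contDiff_smoothTransition_cutoff (n := 2) R
  have e : (fun z : (EuclideanSpace ℝ (Fin 3)) => smoothTransition (2 - ‖z‖ ^ 2 / R ^ 2) ^ 2) = fun z => φ z * φ z := by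
    funext z; rw [sq]
  rw [e, Literature.Analysis.FluidPDE.laplacian_mul_eq (EuclideanSpace.basisFun (Fin 3) ℝ)
    hφ2 hφ2 y]
  have h0 := smoothTransition_cutoff_nonneg R y
  have h1 := smoothTransition_cutoff_le_one R y
  have hΔ := hc₂ R hR y
  have hD := hc₁ R hR y
  have hD0 : 0 ≤ c₁ / R := (norm_nonneg _).trans hD
  -- each `|∂ᵢφ| ≤ ‖Dφ‖`
  have hcoord : ∀ i : Fin 3,
      |fderiv ℝ φ y ((EuclideanSpace.basisFun (Fin 3) ℝ) i)| ≤ c₁ / R := by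
    intro i
    rw [← Real.norm_eq_abs]
    refine (ContinuousLinearMap.le_opNorm _ _).trans ?_
    have hb : ‖(EuclideanSpace.basisFun (Fin 3) ℝ) i‖ = 1 :=
      (EuclideanSpace.basisFun (Fin 3) ℝ).orthonormal.1 i
    rw [hb, mul_one]
    exact hD
  have hsum : |∑ i : Fin 3, fderiv ℝ φ y ((EuclideanSpace.basisFun (Fin 3) ℝ) i) *
      fderiv ℝ φ y ((EuclideanSpace.basisFun (Fin 3) ℝ) i)| ≤ 3 * (c₁ / R) ^ 2 := by
    refine (Finset.abs_sum_le_sum_abs _ _).trans ?_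
    have : ∀ i ∈ (Finset.univ : Finset (Fin 3)),
        |fderiv ℝ φ y ((EuclideanSpace.basisFun (Fin 3) ℝ) i) *
          fderiv ℝ φ y ((EuclideanSpace.basisFun (Fin 3) ℝ) i)| ≤ (c₁ / R) ^ 2 := by
      intro i _
      rw [abs_mul, sq]
      exact mul_le_mul (hcoord i) (hcoord i) (abs_nonneg _) hD0
    refine (Finset.sum_le_sum this).trans ?_
    simp
  have hA : |φ y * (Δ φ) y| ≤ c₂ / R ^ 2 := by
    rw [abs_mul, abs_of_nonneg h0]
    calc φ y * |(Δ φ) y| ≤ 1 * (c₂ / R ^ 2) := mul_le_mul h1 hΔ (abs_nonneg _) zero_le_one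
      _ = c₂ / R ^ 2 := one_mul _
  have h2S : |2 * ∑ i : Fin 3, fderiv ℝ φ y ((EuclideanSpace.basisFun (Fin 3) ℝ) i) *
      fderiv ℝ φ y ((EuclideanSpace.basisFun (Fin 3) ℝ) i)| ≤ 2 * (3 * (c₁ / R) ^ 2) := by
    rw [abs_mul, abs_two]
    exact mul_le_mul_of_nonneg_left hsum zero_le_two
  have h3 := abs_add_three (φ y * (Δ φ) y) (φ y * (Δ φ) y)
    (2 * ∑ i : Fin 3, fderiv ℝ φ y ((EuclideanSpace.basisFun (Fin 3) ℝ) i) *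
      fderiv ℝ φ y ((EuclideanSpace.basisFun (Fin 3) ℝ) i))
  linarith

/-- Off `closedBall 0 (2R)` the Laplacian of `φ_R²` vanishes. [folklore] -/
theorem laplacian_sqCutoff_eq_zero {R : ℝ} (hR : 0 < R) {y : (EuclideanSpace ℝ (Fin 3))}
    (hy : y ∉ closedBall (0 : (EuclideanSpace ℝ (Fin 3))) (2 * R)) :
    (Δ (fun z : (EuclideanSpace ℝ (Fin 3)) => smoothTransition (2 - ‖z‖ ^ 2 / R ^ 2) ^ 2)) y = 0 := by
  refine laplacian_eq_zero_of_notMem_tsupport fun h => hy ?_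
  have hsub : tsupport (fun z : (EuclideanSpace ℝ (Fin 3)) => smoothTransition (2 - ‖z‖ ^ 2 / R ^ 2) ^ 2) ⊆
      closedBall (0 : (EuclideanSpace ℝ (Fin 3))) (2 * R) :=
    closure_minimal (fun z hz => by
      by_contra hz'
      exact hz (sqCutoff_eq_zero_of_notMem hR hz')) isClosed_closedBall
  exact hsub h

end Cutoff

/-! ### The localised enstrophy with the squared weight: time derivative and identity -/

section Dynamic

/-- **Time derivative of `Z_R(s) = ∫ φ_R² ‖Ω(s)‖²`** (differentiation under the integral sign for the
jointly smooth, compactly cut-off integrand; as `signedBudget_hasDerivAt_cutoffEnstrophy` with the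
squared weight). [folklore] -/
theorem hasDerivAt_sqCutoffEnstrophy (hV : IsTypeIAncientMild C V) {R : ℝ} (hR : 0 < R) (s : ℝ) :
    HasDerivAt (fun σ => ∫ y, smoothTransition (2 - ‖y‖ ^ 2 / R ^ 2) ^ 2 * ‖lerayVorticity V σ y‖ ^ 2)
      (∫ y, smoothTransition (2 - ‖y‖ ^ 2 / R ^ 2) ^ 2 *
        (2 * ⟪timeDerivWithin univ (lerayVorticity V) s y, lerayVorticity V s y⟫)) s := by
  have hφ : ContDiff ℝ 1 fun z : (EuclideanSpace ℝ (Fin 3)) => smoothTransition (2 - ‖z‖ ^ 2 / R ^ 2) ^ 2 :=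
    contDiff_sqCutoff (n := 1) R
  have hΦ : ContDiffOn ℝ 1 (Function.uncurry fun (σ : ℝ) (y : (EuclideanSpace ℝ (Fin 3))) =>
      smoothTransition (2 - ‖y‖ ^ 2 / R ^ 2) ^ 2 * ‖lerayVorticity V σ y‖ ^ 2) (univ ×ˢ univ) := by
    have h1 : ContDiff ℝ 1 fun p : ℝ × (EuclideanSpace ℝ (Fin 3)) => smoothTransition (2 - ‖p.2‖ ^ 2 / R ^ 2) ^ 2 :=
      hφ.comp contDiff_snd
    have h2 : ContDiff ℝ 1 fun p : ℝ × (EuclideanSpace ℝ (Fin 3)) => ‖Function.uncurry (lerayVorticity V) p‖ ^ 2 :=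
      ((signedBudget_contDiff_uncurry_lerayVorticity hV).of_le (by exact_mod_cast le_top)).norm_sq ℝ
    exact (h1.mul h2).contDiffOn
  have hsupp : ∀ t ∈ (univ : Set ℝ), ∀ y ∉ closedBall (0 : (EuclideanSpace ℝ (Fin 3))) (2 * R),
      (fun (σ : ℝ) (y : (EuclideanSpace ℝ (Fin 3))) => smoothTransition (2 - ‖y‖ ^ 2 / R ^ 2) ^ 2 *
        ‖lerayVorticity V σ y‖ ^ 2) t y = 0 := by
    intro t _ y hy
    show smoothTransition (2 - ‖y‖ ^ 2 / R ^ 2) ^ 2 * ‖lerayVorticity V t y‖ ^ 2 = 0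
    rw [sqCutoff_eq_zero_of_notMem hR hy, zero_mul]
  have key := hasDerivAt_integral_of_contDiffOn (μ := (volume : Measure (EuclideanSpace ℝ (Fin 3)))) isOpen_univ hΦ
    (isCompact_closedBall (0 : (EuclideanSpace ℝ (Fin 3))) (2 * R)) hsupp (mem_univ s)
  have hΩ1 : ContDiffOn ℝ 1 (Function.uncurry (lerayVorticity V)) (univ ×ˢ univ) :=
    signedBudget_contDiffOn_uncurry_lerayVorticity hV (n := 1)
  have hpt : ∀ y, deriv (fun σ => smoothTransition (2 - ‖y‖ ^ 2 / R ^ 2) ^ 2 *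
      ‖lerayVorticity V σ y‖ ^ 2) s =
      smoothTransition (2 - ‖y‖ ^ 2 / R ^ 2) ^ 2 *
        (2 * ⟪timeDerivWithin univ (lerayVorticity V) s y, lerayVorticity V s y⟫) := by
    intro y
    have h1 := hasDerivAt_timeLine_timeDerivWithin hΩ1 univ_mem y (t := s)
    have h2 := (h1.norm_sq).const_mul (smoothTransition (2 - ‖y‖ ^ 2 / R ^ 2) ^ 2)
    rw [h2.deriv, real_inner_comm]
  have e : (fun y => deriv (fun σ => (fun (σ : ℝ) (y : (EuclideanSpace ℝ (Fin 3))) =>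
      smoothTransition (2 - ‖y‖ ^ 2 / R ^ 2) ^ 2 * ‖lerayVorticity V σ y‖ ^ 2) σ y) s) =
      fun y => smoothTransition (2 - ‖y‖ ^ 2 / R ^ 2) ^ 2 *
        (2 * ⟪timeDerivWithin univ (lerayVorticity V) s y, lerayVorticity V s y⟫) :=
    funext hpt
  rw [e] at key
  exact key

/-- **The budget identity with the squared weight**: `Z_R' = −½Z_R + ½∫(y·∇φ²)‖Ω‖² + ∫(U·∇φ²)‖Ω‖²
+ 2∫φ²⟪DUΩ,Ω⟫ + ∫‖Ω‖²Δφ² − 2∫φ²‖∇Ω‖²_F` (the tree's `signedBudget_enstrophy_identity` at the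
weight `φ_R²`). [folklore] -/
theorem deriv_sqCutoffEnstrophy_eq (hV : IsTypeIAncientMild C V) {R : ℝ} (hR : 0 < R) (s : ℝ) :
    deriv (fun σ => ∫ y, smoothTransition (2 - ‖y‖ ^ 2 / R ^ 2) ^ 2 * ‖lerayVorticity V σ y‖ ^ 2) s =
      -(1 / 2) * (∫ y, smoothTransition (2 - ‖y‖ ^ 2 / R ^ 2) ^ 2 * ‖lerayVorticity V s y‖ ^ 2)
        + (1 / 2) * (∫ y, fderiv ℝ (fun z : (EuclideanSpace ℝ (Fin 3)) => smoothTransition (2 - ‖z‖ ^ 2 / R ^ 2) ^ 2) y y *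
            ‖lerayVorticity V s y‖ ^ 2)
        + (∫ y, fderiv ℝ (fun z : (EuclideanSpace ℝ (Fin 3)) => smoothTransition (2 - ‖z‖ ^ 2 / R ^ 2) ^ 2) y
            (lerayOrbit V s y) * ‖lerayVorticity V s y‖ ^ 2)
        + 2 * (∫ y, smoothTransition (2 - ‖y‖ ^ 2 / R ^ 2) ^ 2 *
            ⟪fderiv ℝ (lerayOrbit V s) y (lerayVorticity V s y), lerayVorticity V s y⟫)
        + (∫ y, ‖lerayVorticity V s y‖ ^ 2 *
            (Δ (fun z : (EuclideanSpace ℝ (Fin 3)) => smoothTransition (2 - ‖z‖ ^ 2 / R ^ 2) ^ 2)) y)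
        - 2 * (∫ y, smoothTransition (2 - ‖y‖ ^ 2 / R ^ 2) ^ 2 *
            frobeniusNormSq (fderiv ℝ (lerayVorticity V s) y)) := by
  rw [(hasDerivAt_sqCutoffEnstrophy hV hR s).deriv]
  exact signedBudget_enstrophy_identity hV (contDiff_sqCutoff (n := ⊤) R)
    (hasCompactSupport_sqCutoff hR) s

end Dynamic

end Summit.NavierStokesRegularity.NavierStokesRegularity.Theorems.SmallDissipationGap

end
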